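import Summits.PneNP.PneNP.Theorems.ChebyshevTracialDesignAPrioriPsd
import Summits.PneNP.PneNP.Theorems.ChebyshevTracialDesignExpOfLog
import Summits.PneNP.PneNP.Theorems.ChebyshevTracialDesignSpectralNonTightnessEstimates
import Mathlib.Analysis.SpecificLimits.Basic
import HarnessLib

/-!
# Cell pnp-psdrank, route `ChebyshevTracialDesign`: the a-priori bound in closed form —
# `TracialValueLEAt W (36·n^{−3/2} + (c' + B)·√P_D) r` for every balanced exact design and every dimension `r`

Harmonic backbone of the crux `TracialDecayExp20` (stmt-PneNP-19878), brick 45f (prover g10): the explicit sums of brick 45e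
(`tracialValueLEAt_apriori`) evaluated. For `n` even, an exact design `(n, t = 2c'+1, T, D, B, C, w)` with `n ≤ 4t` (balanced cut sizes,
as in the route's `IsBalancedDesign`), `D ≤ 2c'` and `20·D + 16 ≤ n`:
* §1 `layerRatio_sub_one_le` — `R_κ − 1 ≤ 18κ/n` for `1 ≤ κ ≤ D/2` (brick 45c `layerRatio_le_one_add` with `y ≤ 9/n`);
* §2 `mul_sqrtAtten_le` — `κ·√A_κ ≤ n^{−1/2}·2^{1−κ}` for `1 ≤ κ ≤ D/2` (ratio test, `34κ + 16 ≤ n`), hence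
  `Σ_{κ=1}^{D/2} (R_κ − 1)·√A_κ ≤ 36/(n√n)` (`low_modes_le`);
* §3 `deep_modes_le` — `Σ_{κ=D/2+1}^{c'} √A_κ ≤ c'·√P_D` (brick 28's `atten_mono`: `A_κ ≤ A_K` for `K ≤ κ ≤ c'`, `4c'+1 ≤ n`);
* §4 **`tracialValueLEAt_apriori_explicit`** — `TracialValueLEAt (levelWeight n t C w) (36/(n·√n) + (c' + B)·√P_D) r` for every `r ≥ 1`,
  `P_D = Π_{i<D/2+1}(2i+1)/(n−2i)`: UNCONDITIONALLY, no tight psd strategy of any dimension has tracial value above `≈ 36·r·n^{−3/2}`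
  (the deep term is `n^{−Ω(D)}`); the crux `TracialDecayExp20` asks for `r·e^{−a·dq n}` instead.
[cite: Grigoriev2001, Lemma 1.4 (PDF p. 8)] [cite: Rothvoss2017, §2 (PDF p. 6)] [cite: GriblingDelaatLaurent2019, §5]
Stature: support/instrument (no defs), UNCONDITIONAL. WHAT THIS IS NOT: not the crux (polynomial smallness only); nothing on psd rank; no P-vs-NP
content. Supports stmt-PneNP-19878.
-/

set_option linter.dupNamespace false -- `Summit.PneNP.PneNP.…`: summit = sub-problem (D-0017)

noncomputable section

namespace Summit.PneNP.PneNP.Theorems.ChebyshevTracialDesignAPrioriPsdExplicit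

open Finset Matrix Literature.Barriers.PneNP Literature.Computability.Complexity Literature.Combinatorics.Optimization
open Summit.PneNP.PneNP.Theorems.ChebyshevTracialDesignTightModeBudget (layerRatio_le_one_add)
open Summit.PneNP.PneNP.Theorems.ChebyshevTracialDesignVirtualLayerRatio (one_le_layerRatio)
open Summit.PneNP.PneNP.Theorems.ChebyshevTracialDesignAPrioriPsd (tracialValueLEAt_apriori)
open Summit.PneNP.PneNP.Theorems.ChebyshevTracialDesignAssembly (tracialValueLEAt_mono)
open Summit.PneNP.PneNP.Theorems.ChebyshevTracialDesignSpectralNonTightnessEstimates (atten_mono)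

variable {n : ℕ}

/-! ### §1 The layer ratio on balanced cuts: `R_κ − 1 ≤ 18κ/n` -/

/-- **`R_κ − 1 ≤ 18κ/n`** for `1 ≤ κ ≤ D/2`, `t = 2c'+1` with `n ≤ 4t`, `2t + 2 ≤ n`, `20D + 16 ≤ n` (then `y ≤ 9/n` and `2κy ≤ 1` in
brick 45c's `layerRatio_le_one_add`). [cite: Grigoriev2001, Lemma 1.4 (PDF p. 8)] -/
theorem layerRatio_sub_one_le {c' D κ : ℕ} (ht : 2 * (2 * c' + 1) + 2 ≤ n) (hbal : n ≤ 4 * (2 * c' + 1)) (hDn : 20 * D + 16 ≤ n)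
    (hκ : κ ≤ D / 2) :
    ∏ i ∈ range κ, (((2 * c' + 1 : ℝ) - 2 * i) * ((n : ℝ) - 2 * c' - 1 - 2 * i) /
        (((2 * c' : ℝ) - 2 * i) * ((n : ℝ) - 2 * c' - 2 - 2 * i))) - 1 ≤ 18 * κ / n := by
  have hn0 : (0 : ℝ) < n := by exact_mod_cast (show 0 < n by omega)
  -- the two gaps `x₀ = 2c'+2−2κ ≥ n/5`, `z₀ = n−2c'−2κ ≥ n/3`
  have hx : (n : ℝ) / 5 ≤ (2 * c' + 2 : ℝ) - 2 * κ := by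
    have : (n : ℝ) + 10 * κ ≤ 10 * c' + 10 := by exact_mod_cast (show n + 10 * κ ≤ 10 * c' + 10 by omega)
    linarith
  have hz : (n : ℝ) / 3 ≤ (n : ℝ) - 2 * c' - 2 * κ := by
    have : (6 * c' + 6 * κ : ℝ) ≤ 2 * n := by exact_mod_cast (show 6 * c' + 6 * κ ≤ 2 * n by omega)
    linarith
  have hxpos : 0 < (2 * c' + 2 : ℝ) - 2 * κ := lt_of_lt_of_le (by positivity) hx
  have hzpos : 0 < (n : ℝ) - 2 * c' - 2 * κ := lt_of_lt_of_le (by positivity) hz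
  -- `y ≤ 5/n + 3/n + 15/n² ≤ 9/n`
  have hy1 : 1 / ((2 * c' + 2 : ℝ) - 2 * κ) ≤ 5 / n := by
    rw [div_le_div_iff₀ hxpos hn0]; linarith
  have hy2 : 1 / ((n : ℝ) - 2 * c' - 2 * κ) ≤ 3 / n := by
    rw [div_le_div_iff₀ hzpos hn0]; linarith
  have hy3 : 1 / (((2 * c' + 2 : ℝ) - 2 * κ) * ((n : ℝ) - 2 * c' - 2 * κ)) ≤ 1 / n := by
    rw [div_le_div_iff₀ (mul_pos hxpos hzpos) hn0]
    have h15 : (15 : ℝ) ≤ n := by exact_mod_cast (show 15 ≤ n by omega)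
    nlinarith [mul_le_mul hx hz (by positivity) hxpos.le]
  have hy : 1 / ((2 * c' + 2 : ℝ) - 2 * κ) + 1 / ((n : ℝ) - 2 * c' - 2 * κ) +
      1 / (((2 * c' + 2 : ℝ) - 2 * κ) * ((n : ℝ) - 2 * c' - 2 * κ)) ≤ 9 / n := by
    have : (5 : ℝ) / n + 3 / n + 1 / n = 9 / n := by ring
    linarith
  have hy0 : 0 ≤ 1 / ((2 * c' + 2 : ℝ) - 2 * κ) + 1 / ((n : ℝ) - 2 * c' - 2 * κ) +
      1 / (((2 * c' + 2 : ℝ) - 2 * κ) * ((n : ℝ) - 2 * c' - 2 * κ)) := by positivity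
  have hκ0 : (0 : ℝ) ≤ κ := Nat.cast_nonneg _
  have hsmall : 2 * κ * (1 / ((2 * c' + 2 : ℝ) - 2 * κ) + 1 / ((n : ℝ) - 2 * c' - 2 * κ) +
      1 / (((2 * c' + 2 : ℝ) - 2 * κ) * ((n : ℝ) - 2 * c' - 2 * κ))) ≤ 1 := by
    have hκD : (2 * κ : ℝ) ≤ D := by exact_mod_cast (show 2 * κ ≤ D by omega)
    have hD9 : (D : ℝ) * (9 / n) ≤ 1 := by
      rw [mul_div_assoc', div_le_one hn0]; exact_mod_cast (show D * 9 ≤ n by omega)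
    calc 2 * κ * _ ≤ (D : ℝ) * (9 / n) := mul_le_mul hκD hy hy0 (Nat.cast_nonneg _)
      _ ≤ 1 := hD9
  have h := layerRatio_le_one_add (n := n) (a := c') (κ := κ) (by omega) (by omega) hsmall
  calc _ ≤ 2 * κ * (1 / ((2 * c' + 2 : ℝ) - 2 * κ) + 1 / ((n : ℝ) - 2 * c' - 2 * κ) +
      1 / (((2 * c' + 2 : ℝ) - 2 * κ) * ((n : ℝ) - 2 * c' - 2 * κ))) := by linarith
    _ ≤ 2 * κ * (9 / n) := mul_le_mul_of_nonneg_left hy (by positivity)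
    _ = 18 * κ / n := by ring

/-! ### §2 The low modes: `κ·√A_κ ≤ 2^{1−κ}/√n` and `Σ_{κ=1}^{D/2} (R_κ−1)·√A_κ ≤ 36/(n√n)` -/

/-- The attenuation products are nonnegative: `0 ≤ A_κ` for `2κ ≤ n`. -/
theorem atten_nonneg {κ : ℕ} (hκ : 2 * κ ≤ n) : 0 ≤ ∏ i ∈ range κ, ((2 * i + 1 : ℝ) / ((n : ℝ) - 2 * i)) :=
  prod_nonneg fun i hi => by
    have hi' := mem_range.1 hi
    have : (2 * i + 2 : ℝ) ≤ n := by exact_mod_cast (show 2 * i + 2 ≤ n by omega)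
    exact div_nonneg (by positivity) (by linarith)

/-- **`κ·√A_κ ≤ (1/√n)·(1/2)^{κ−1}`** for `1 ≤ κ` and `34(κ−1) + 16 ≤ n` (ratio test: `(κ+1)√((2κ+1)/(n−2κ)) ≤ κ/2` when `34κ+16 ≤ n`).
[cite: Grigoriev2001, Lemma 1.4 (PDF p. 8)] -/
theorem mul_sqrtAtten_le : ∀ κ : ℕ, 1 ≤ κ → 34 * (κ - 1) + 16 ≤ n →
    (κ : ℝ) * Real.sqrt (∏ i ∈ range κ, ((2 * i + 1 : ℝ) / ((n : ℝ) - 2 * i))) ≤ (1 / Real.sqrt n) * (1 / 2) ^ (κ - 1)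
  | 0, h, _ => absurd h (by norm_num)
  | 1, _, _ => by
      simp only [Nat.cast_one, one_mul, prod_range_one, Nat.cast_zero, mul_zero, zero_add, sub_zero, Nat.sub_self, pow_zero, mul_one]
      rw [Real.sqrt_div' _ (Nat.cast_nonneg _), Real.sqrt_one]
  | (κ + 2), _, hκn => by
      have hrec := mul_sqrtAtten_le (κ + 1) (by omega) (by omega)
      have hn2 : (2 * κ + 4 : ℝ) ≤ n := by exact_mod_cast (show 2 * κ + 4 ≤ n by omega)
      have hA0 : 0 ≤ ∏ i ∈ range (κ + 1), ((2 * i + 1 : ℝ) / ((n : ℝ) - 2 * i)) := atten_nonneg (by omega)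
      have hqden : 0 < (n : ℝ) - 2 * (κ + 1 : ℕ) := by push_cast; linarith
      have hq0 : 0 ≤ ((2 * ((κ + 1 : ℕ) : ℝ) + 1) / ((n : ℝ) - 2 * ((κ + 1 : ℕ) : ℝ))) := div_nonneg (by positivity) hqden.le
      rw [prod_range_succ, Real.sqrt_mul hA0]
      -- the ratio step `(κ+2)·√q ≤ (κ+1)/2`
      have hratio : ((κ + 2 : ℕ) : ℝ) * Real.sqrt ((2 * ((κ + 1 : ℕ) : ℝ) + 1) / ((n : ℝ) - 2 * ((κ + 1 : ℕ) : ℝ))) ≤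
          ((κ + 1 : ℕ) : ℝ) / 2 := by
        rw [← Real.sqrt_sq (show (0 : ℝ) ≤ ((κ + 2 : ℕ) : ℝ) from Nat.cast_nonneg _), ← Real.sqrt_mul (sq_nonneg _),
          ← Real.sqrt_sq (show (0 : ℝ) ≤ ((κ + 1 : ℕ) : ℝ) / 2 by positivity)]
        refine Real.sqrt_le_sqrt ?_
        rw [← mul_div_assoc, div_le_iff₀ hqden]
        push_cast
        have hκ0 : (0 : ℝ) ≤ κ := Nat.cast_nonneg _
        have hn34 : (34 * (κ + 1) + 16 : ℝ) ≤ n := by exact_mod_cast (show 34 * (κ + 1) + 16 ≤ n by omega)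
        nlinarith [mul_nonneg hκ0 hκ0, mul_nonneg (mul_nonneg hκ0 hκ0) hκ0, mul_le_mul_of_nonneg_left hn34 (mul_nonneg hκ0 hκ0),
          mul_le_mul_of_nonneg_left hn34 hκ0]
      have hs0 : 0 ≤ Real.sqrt (∏ i ∈ range (κ + 1), ((2 * i + 1 : ℝ) / ((n : ℝ) - 2 * i))) := Real.sqrt_nonneg _
      calc ((κ + 2 : ℕ) : ℝ) * (Real.sqrt (∏ i ∈ range (κ + 1), ((2 * i + 1 : ℝ) / ((n : ℝ) - 2 * i))) *
            Real.sqrt ((2 * ((κ + 1 : ℕ) : ℝ) + 1) / ((n : ℝ) - 2 * ((κ + 1 : ℕ) : ℝ))))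
          = (((κ + 2 : ℕ) : ℝ) * Real.sqrt ((2 * ((κ + 1 : ℕ) : ℝ) + 1) / ((n : ℝ) - 2 * ((κ + 1 : ℕ) : ℝ)))) *
              Real.sqrt (∏ i ∈ range (κ + 1), ((2 * i + 1 : ℝ) / ((n : ℝ) - 2 * i))) := by ring
        _ ≤ (((κ + 1 : ℕ) : ℝ) / 2) * Real.sqrt (∏ i ∈ range (κ + 1), ((2 * i + 1 : ℝ) / ((n : ℝ) - 2 * i))) :=
            mul_le_mul_of_nonneg_right hratio hs0
        _ = (((κ + 1 : ℕ) : ℝ) * Real.sqrt (∏ i ∈ range (κ + 1), ((2 * i + 1 : ℝ) / ((n : ℝ) - 2 * i)))) * (1 / 2) := by ring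
        _ ≤ ((1 / Real.sqrt n) * (1 / 2) ^ (κ + 1 - 1)) * (1 / 2) := mul_le_mul_of_nonneg_right hrec (by norm_num)
        _ = (1 / Real.sqrt n) * (1 / 2) ^ (κ + 2 - 1) := by
            rw [show κ + 2 - 1 = (κ + 1 - 1) + 1 by omega, pow_succ]; ring

/-- **The low modes**: `Σ_{κ=1}^{D/2} (R_κ − 1)·√A_κ ≤ 36/(n·√n)` under `n ≤ 4t`, `2t+2 ≤ n`, `20D + 16 ≤ n`.
[cite: Grigoriev2001, Lemma 1.4 (PDF p. 8)] -/
theorem low_modes_le {c' D : ℕ} (ht : 2 * (2 * c' + 1) + 2 ≤ n) (hbal : n ≤ 4 * (2 * c' + 1)) (hDn : 20 * D + 16 ≤ n) :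
    ∑ κ ∈ Icc 1 (D / 2), ((∏ i ∈ range κ, (((2 * c' + 1 : ℝ) - 2 * i) * ((n : ℝ) - 2 * c' - 1 - 2 * i) /
        (((2 * c' : ℝ) - 2 * i) * ((n : ℝ) - 2 * c' - 2 - 2 * i)))) - 1) *
        Real.sqrt (∏ i ∈ range κ, ((2 * i + 1 : ℝ) / ((n : ℝ) - 2 * i))) ≤ 36 / ((n : ℝ) * Real.sqrt n) := by
  have hn0 : (0 : ℝ) < n := by exact_mod_cast (show 0 < n by omega)
  have hsn : 0 < Real.sqrt n := Real.sqrt_pos.2 hn0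
  -- termwise: `(R_κ − 1)√A_κ ≤ (18/n)·(κ√A_κ) ≤ (18/n)(1/√n)(1/2)^{κ−1}`
  have hterm : ∀ κ ∈ Icc 1 (D / 2), ((∏ i ∈ range κ, (((2 * c' + 1 : ℝ) - 2 * i) * ((n : ℝ) - 2 * c' - 1 - 2 * i) /
      (((2 * c' : ℝ) - 2 * i) * ((n : ℝ) - 2 * c' - 2 - 2 * i)))) - 1) *
        Real.sqrt (∏ i ∈ range κ, ((2 * i + 1 : ℝ) / ((n : ℝ) - 2 * i))) ≤ (18 / n) * ((1 / Real.sqrt n) * (1 / 2) ^ (κ - 1)) := by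
    intro κ hκ
    obtain ⟨h1, h2⟩ := mem_Icc.1 hκ
    have hR := layerRatio_sub_one_le (c' := c') (D := D) ht hbal hDn h2
    have hks := mul_sqrtAtten_le (n := n) κ h1 (by omega)
    calc _ ≤ (18 * κ / n) * Real.sqrt (∏ i ∈ range κ, ((2 * i + 1 : ℝ) / ((n : ℝ) - 2 * i))) :=
          mul_le_mul_of_nonneg_right hR (Real.sqrt_nonneg _)
      _ = (18 / n) * ((κ : ℝ) * Real.sqrt (∏ i ∈ range κ, ((2 * i + 1 : ℝ) / ((n : ℝ) - 2 * i)))) := by ring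
      _ ≤ (18 / n) * ((1 / Real.sqrt n) * (1 / 2) ^ (κ - 1)) := mul_le_mul_of_nonneg_left hks (by positivity)
  have hgeom : ∑ κ ∈ Icc 1 (D / 2), (1 / 2 : ℝ) ^ (κ - 1) ≤ 2 := by
    have hre : ∑ κ ∈ Icc 1 (D / 2), (1 / 2 : ℝ) ^ (κ - 1) = ∑ j ∈ range (D / 2), (1 / 2 : ℝ) ^ j := by
      rw [show Icc 1 (D / 2) = (range (D / 2)).map (addRightEmbedding 1) by
        ext κ; simp only [mem_Icc, mem_map, mem_range, addRightEmbedding_apply]; constructor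
        · intro h; exact ⟨κ - 1, by omega, by omega⟩
        · rintro ⟨j, hj, rfl⟩; omega]
      rw [sum_map]
      exact sum_congr rfl fun j _ => by simp
    rw [hre]
    exact sum_geometric_two_le _
  calc _ ≤ ∑ κ ∈ Icc 1 (D / 2), (18 / n) * ((1 / Real.sqrt n) * (1 / 2 : ℝ) ^ (κ - 1)) := sum_le_sum hterm
    _ = (18 / n) * (1 / Real.sqrt n) * ∑ κ ∈ Icc 1 (D / 2), (1 / 2 : ℝ) ^ (κ - 1) := by rw [mul_sum]; exact sum_congr rfl fun κ _ => by ring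
    _ ≤ (18 / n) * (1 / Real.sqrt n) * 2 := mul_le_mul_of_nonneg_left hgeom (by positivity)
    _ = 36 / ((n : ℝ) * Real.sqrt n) := by field_simp; ring

/-! ### §3 The deep modes: `Σ_{κ=D/2+1}^{c'} √A_κ ≤ c'·√P_D` -/

/-- **The deep modes**: `Σ_{κ=D/2+1}^{c'} √A_κ ≤ c'·√P_D`, `P_D = A_{D/2+1}`, when `2(2c'+1) ≤ n`. [cite: Grigoriev2001, Lemma 1.4 (PDF p. 8)] -/
theorem deep_modes_le {c' D : ℕ} (ht : 2 * (2 * c' + 1) ≤ n) :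
    ∑ κ ∈ Icc (D / 2 + 1) c', Real.sqrt (∏ i ∈ range κ, ((2 * i + 1 : ℝ) / ((n : ℝ) - 2 * i))) ≤
      (c' : ℝ) * Real.sqrt (∏ i ∈ range (D / 2 + 1), ((2 * i + 1 : ℝ) / ((n : ℝ) - 2 * i))) := by
  calc _ ≤ ∑ _κ ∈ Icc (D / 2 + 1) c', Real.sqrt (∏ i ∈ range (D / 2 + 1), ((2 * i + 1 : ℝ) / ((n : ℝ) - 2 * i))) :=
        sum_le_sum fun κ hκ => Real.sqrt_le_sqrt (atten_mono (mem_Icc.1 hκ).1 (by have := (mem_Icc.1 hκ).2; omega))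
    _ = ((c' + 1 - (D / 2 + 1) : ℕ) : ℝ) * Real.sqrt (∏ i ∈ range (D / 2 + 1), ((2 * i + 1 : ℝ) / ((n : ℝ) - 2 * i))) := by
        rw [sum_const, Nat.card_Icc, nsmul_eq_mul]
    _ ≤ _ := mul_le_mul_of_nonneg_right (by exact_mod_cast (show c' + 1 - (D / 2 + 1) ≤ c' by omega)) (Real.sqrt_nonneg _)

/-! ### §4 The a-priori bound in closed form -/

/-- **THE A-PRIORI BOUND, CLOSED FORM (unconditional, every dimension).** For `n` even and every exact design
`(n, t = 2c'+1, T, D, B, C, w)` with `n ≤ 4t`, `D ≤ 2c'`, `20D + 16 ≤ n`, and every `r ≥ 1`: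
`TracialValueLEAt (levelWeight n t C w) (36/(n·√n) + (c' + B)·√P_D) r`, `P_D = Π_{i<D/2+1}(2i+1)/(n−2i)`.
[cite: Grigoriev2001, Lemma 1.4 (PDF p. 8)] [cite: Rothvoss2017, §2 (PDF p. 6)] [cite: GriblingDelaatLaurent2019, §5] -/
theorem tracialValueLEAt_apriori_explicit {c' T D r : ℕ} {Bv : ℝ} {C : Finset ℕ} {w : ℕ → ℝ} (hn : Even n)
    (hdes : IsExactDesign n (2 * c' + 1) T D Bv C w) (hbal : n ≤ 4 * (2 * c' + 1)) (hD : D ≤ 2 * c') (hDn : 20 * D + 16 ≤ n)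
    (hr : 0 < r) :
    TracialValueLEAt (levelWeight n (2 * c' + 1) C w)
      (36 / ((n : ℝ) * Real.sqrt n) + ((c' : ℝ) + Bv) * Real.sqrt (∏ i ∈ range (D / 2 + 1), ((2 * i + 1 : ℝ) / ((n : ℝ) - 2 * i)))) r := by
  have ht : 2 * (2 * c' + 1) + 2 ≤ n := hdes.2.1
  have h := tracialValueLEAt_apriori hn hdes hD hr
  refine tracialValueLEAt_mono _ ?_ r h
  have h1 := low_modes_le (c' := c') (D := D) ht hbal hDn
  have h2 := deep_modes_le (n := n) (c' := c') (D := D) (by omega)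
  nlinarith [h1, h2]

end Summit.PneNP.PneNP.Theorems.ChebyshevTracialDesignAPrioriPsdExplicit
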